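import Summits.CriticalPhenomena.SAWScalingLimit.Theorems.SAWDevelopingMapHexConjectureWindowIneqOfAspectBound
import Summits.CriticalPhenomena.SAWScalingLimit.Theorems.SAWDevelopingMapHexConjectureWindowLowerBoundOfWindowIneq
import Summits.CriticalPhenomena.SAWScalingLimit.Theorems.SAWDevelopingMapHexConjectureFloorRatioTransport
import Summits.CriticalPhenomena.SAWScalingLimit.Theorems.SAWDevelopingMapHexConjectureConformalPackageGrowth
import Summits.CriticalPhenomena.SAWScalingLimit.Theorems.SAWDevelopingMapHexConjectureRestrictionCocycleOfWindowLocality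
import HarnessLib

/-!
# Crux `HexConjecture` (stmt-CriticalPhenomena-0808), line `root-locality-replaces-loewner`:
the admissible restriction cocycle from the floor-ratio limit and the ARCH ASPECT BOUND

Landing target:
`Summits/CriticalPhenomena/SAWScalingLimit/Theorems/SAWDevelopingMapHexConjectureRestrictionCocycleOfAspectBound.lean`
(`--supports stmt-CriticalPhenomena-0808`; lead continuation prover-line-stmt-CriticalPhenomena-0808-c6-0).

`restrictionCocycle_of_aspectBound`: the conclusion of crux-10472's bootstrap `FloorRatio.stub_restrictionCocycle` (p90257),
of `RootLocality.restrictionCocycle_of_floorRatioModulus` (p116941) and of `restrictionCocycle_of_windowLocality` (p123521)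
VERBATIM — `Z_{Λ'δ}(a δ, b δ)/Z_{Λδ}(a δ, b δ) → Φ_A'(0)^{5/8}` for nested admissible families of a floor domain and a hull
subdomain — from the modulus floor-ratio limit (first hypothesis, unchanged) and, in place of the window-averaged arch
locality WAL (an `η`-statement: far mass ≤ `η ×` near mass on the window), the `η`-FREE **arch aspect bound** (AAB):
ONE constant `C` such that for all `θ₁ < θa` and all large `R` the far (reach-`R`) mass summed over the floor window
`[θ₁R, θaR]` is at most `C` times the half-disc mass summed over the reference window `[θaR, θbR]`.
Mechanism (the c6 reshape, "the floor-ratio limit supplies the window gain"): the conformal package is upgraded with the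
GROWTH of the boundary profile `G(t) = exp((5/8)Re(Ls(t) − Lb)) ≥ κ t^{-5/4}` at the root (simple pole of `Ψ = −1/φ⁻¹`;
`exists_conformalPackageGrowth`, reflection at the root); the single-domain floor-ratio transport
(`floorFamily_ratioTransport`, p125163) attains `G` along every admissible floor family, hence uniformly over windows
(`ratio_uniform_window`, p125150); the window mass therefore exceeds any multiple of `δ⁻¹ Z(a,b)` once `θ₁` is small
(`window_block_sum_ge`, p125166: `t^{-5/4}` is not integrable at `0`) while AAB and the same uniformity bound the far mass
by a FIXED multiple of `δ⁻¹ Z(a,b)` — this is the window inequality (`windowIneq_of_aspectBound`) consumed by the window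
maximiser (`windowMaximiser_of_windowIneq`, p125107) in the lower bound of the squeeze (`windowLowerBound_of_windowIneq`);
the upper bound and the final arithmetic are c5's (`windowUpperBound`, `squeeze_abs_lt`).
Then the line's floor-class compositions with the lever AAB: `hexAvoidanceCocycleFloor_of_aspectBound`,
`hexConjectureFloor_of_aspectBound` (+ non-retracing), `hexConjectureFloor_of_aspectEstimates` (+ uniform modulus).
Sources: LawlerSchrammWerner2003 (Thm 6.1), LawlerSchrammWerner2004SAW (§3.4, Prop. 2), DuminilCopinSmirnov2012 (Lemma 2);
the reduction of AAB to triangle-walk tails is KrachunPanagiotis2023 (arXiv:2310.17299), Cor. 3.1 and eq. (2).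
-/

noncomputable section

open scoped BigOperators Topology NNReal ENNReal Classical
open Filter Set MeasureTheory Metric
open Literature.Probability.LatticeModels (HexVertex hexGraph hexCenter Site)
open Literature.Probability.RandomPlanarGeometry
open Literature.Probability.RandomPlanarGeometry.SAW
open UpperHalfPlane (upperHalfPlaneSet)

namespace Summit.CriticalPhenomena.SAWScalingLimit.Theorems.HexConjecture.RootLocality

open Summit.CriticalPhenomena.SAWScalingLimit.Theorems.ObservableToSLE.FloorRatio

/-! ### A distance on the floor line -/

/-- The floor point `p + t`, `t > 0`, lies at distance `t` from `p`. [folklore] -/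
theorem dist_pt_add_real (p : ℂ) {t : ℝ} (ht : 0 < t) : dist (p + (t : ℂ)) p = t := by
  rw [dist_eq_norm, add_sub_cancel_left, Complex.norm_real, Real.norm_eq_abs, abs_of_pos ht]

/-! ### The bootstrap with the arch aspect bound -/

/-- **The admissible restriction cocycle from the modulus floor-ratio limit and the ARCH ASPECT BOUND.**  Conclusion
and first hypothesis verbatim those of `restrictionCocycle_of_floorRatioModulus` (p116941) /
`restrictionCocycle_of_windowLocality` (p123521); the second hypothesis is the `η`-free arch aspect bound.  See the module
docstring for the proof. [cite: LawlerSchrammWerner2004SAW, §3.4 ("SAW satisfies restriction") and Prop. 2] -/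
theorem restrictionCocycle_of_aspectBound :
    (∀ (D D' : DobrushinDomain) (ρ : ℝ) (Λ : ℝ → Finset HexVertex) (m₀ m m' : ℝ → ℤ)
      (a b b' : ℝ → Sym2 HexVertex) (Φ : ConformalEquiv D.carrier upperHalfPlaneSet)
      (L : ℂ → ℂ) (Lb Lb' : ℂ),
      D'.carrier = D.carrier → D'.pt 0 = D.pt 0 → 0 < ρ →
      D.carrier ∩ ball (D.pt 0) ρ = {z : ℂ | (D.pt 0).im < z.im} ∩ ball (D.pt 0) ρ →
      D.carrier ∩ ball (D.pt 1) ρ = {z : ℂ | (D.pt 1).im < z.im} ∩ ball (D.pt 1) ρ →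
      D.carrier ∩ ball (D'.pt 1) ρ = {z : ℂ | (D'.pt 1).im < z.im} ∩ ball (D'.pt 1) ρ →
      (∀ᶠ δ : ℝ in 𝓝[>] 0,
        hexDomainSimplyConnected (Λ δ) ∧ a δ ∈ hexDomainBoundary (Λ δ) ∧
        b δ ∈ hexDomainBoundary (Λ δ) ∧ b' δ ∈ hexDomainBoundary (Λ δ) ∧
        Nonempty (HexMidEdgeSAW (Λ δ) (a δ) (b δ)) ∧ Nonempty (HexMidEdgeSAW (Λ δ) (a δ) (b' δ)) ∧
        (hexGraph.induce (↑(Λ δ) : Set HexVertex)).Preconnected ∧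
        (∀ v ∈ Λ δ, (δ : ℂ) * hexCenter v ∈ D.carrier) ∧
        (∀ v : HexVertex, (δ : ℂ) * hexCenter v ∈ ball (D.pt 0) ρ → (v ∈ Λ δ ↔ m₀ δ ≤ v.1 1)) ∧
        (∀ v : HexVertex, (δ : ℂ) * hexCenter v ∈ ball (D.pt 1) ρ → (v ∈ Λ δ ↔ m δ ≤ v.1 1)) ∧
        (∀ v : HexVertex, (δ : ℂ) * hexCenter v ∈ ball (D'.pt 1) ρ → (v ∈ Λ δ ↔ m' δ ≤ v.1 1))) →
      (∀ K : Set ℂ, IsCompact K → K ⊆ D.carrier →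
        ∀ᶠ δ : ℝ in 𝓝[>] 0, ∀ v : HexVertex, (δ : ℂ) * hexCenter v ∈ K → v ∈ Λ δ) →
      Tendsto (fun δ : ℝ => (δ : ℂ) * hexMidpoint (a δ)) (𝓝[>] 0) (𝓝 (D.pt 0)) →
      Tendsto (fun δ : ℝ => (δ : ℂ) * hexMidpoint (b δ)) (𝓝[>] 0) (𝓝 (D.pt 1)) →
      Tendsto (fun δ : ℝ => (δ : ℂ) * hexMidpoint (b' δ)) (𝓝[>] 0) (𝓝 (D'.pt 1)) →
      Tendsto (fun x => ‖Φ x‖) (𝓝[D.carrier] (D.pt 0)) atTop →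
      Φ.HasBoundaryValue (D.pt 1) 0 →
      ContinuousOn L D.carrier → (∀ z ∈ D.carrier, Complex.exp (L z) = deriv Φ z) →
      Tendsto L (𝓝[D.carrier] (D.pt 1)) (𝓝 Lb) → Tendsto L (𝓝[D.carrier] (D'.pt 1)) (𝓝 Lb') →
      Tendsto (fun δ : ℝ =>
        ‖hexParafermionicObservable (Λ δ) (a δ) hexCriticalFugacity (5 / 8) (b' δ) /
          hexParafermionicObservable (Λ δ) (a δ) hexCriticalFugacity (5 / 8) (b δ)‖) (𝓝[>] 0)
        (𝓝 (Real.exp ((5 / 8) * (Lb' - Lb).re)))) →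
    (∃ θa θb C : ℝ, 0 < θa ∧ θa < θb ∧ θb ≤ 1 / 4 ∧ 0 < C ∧ ∀ θ₁ : ℝ, 0 < θ₁ → θ₁ < θa →
      ∃ R₀ : ℝ, 0 < R₀ ∧ ∀ R : ℝ, R₀ ≤ R →
      ∀ (x : Site 2) (L B : Finset HexVertex) (S S' : Finset ℤ),
        (∀ v ∈ L, x 1 ≤ v.1 1) →
        (∀ v : HexVertex, v ∈ B ↔ (x 1 ≤ v.1 1 ∧
          dist (hexCenter v) (hexMidpoint s((x - Pi.single 1 1, 1), (x, 0))) ≤ R)) →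
        (∀ d : ℤ, d ∈ S ↔ (θ₁ * R ≤ (d : ℝ) ∧ (d : ℝ) ≤ θa * R)) →
        (∀ d : ℤ, d ∈ S' ↔ (θa * R ≤ (d : ℝ) ∧ (d : ℝ) ≤ θb * R)) →
        ∑ d ∈ S, (∑ γ : HexMidEdgeSAW L s((x - Pi.single 1 1, 1), (x, 0))
            s((x + Pi.single 0 d - Pi.single 1 1, 1), (x + Pi.single 0 d, 0)),
          if ∃ v ∈ γ.verts, R ≤ dist (hexCenter v) (hexMidpoint s((x - Pi.single 1 1, 1), (x, 0)))
          then hexCriticalFugacity ^ γ.length else 0) ≤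
        C * ∑ d ∈ S', ∑ γ : HexMidEdgeSAW B s((x - Pi.single 1 1, 1), (x, 0))
            s((x + Pi.single 0 d - Pi.single 1 1, 1), (x + Pi.single 0 d, 0)), hexCriticalFugacity ^ γ.length) →
  ∀ (D D' : DobrushinDomain) (ρ : ℝ) (φ : ConformalEquiv upperHalfPlaneSet D.carrier)
  (Φ : ConformalEquiv (upperHalfPlaneSet \ φ.pullbackHull D') upperHalfPlaneSet) (d : ℝ)
  (Λ Λ' : ℝ → Finset HexVertex) (m : ℝ → ℤ) (a b : ℝ → Sym2 HexVertex),
  (0 < ρ ∧ (D.pt 1).im = (D.pt 0).im ∧ D.carrier ⊆ {z : ℂ | (D.pt 0).im < z.im} ∧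
  D.carrier ∩ ball (D.pt 0) ρ = {z : ℂ | (D.pt 0).im < z.im} ∩ ball (D.pt 0) ρ ∧
  D.carrier ∩ ball (D.pt 1) ρ = {z : ℂ | (D.pt 1).im < z.im} ∩ ball (D.pt 1) ρ) → D.IsHullSubdomain D' → D.IsChordalUniformizing φ →
  IsRestrictionMap (φ.pullbackHull D') Φ → HasRestrictionDeriv (φ.pullbackHull D') Φ d →
  (∀ᶠ δ : ℝ in 𝓝[>] 0,
  Λ' δ ⊆ Λ δ ∧ hexDomainSimplyConnected (Λ δ) ∧ hexDomainSimplyConnected (Λ' δ) ∧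
  (hexGraph.induce (↑(Λ δ) : Set HexVertex)).Preconnected ∧
  (hexGraph.induce (↑(Λ' δ) : Set HexVertex)).Preconnected ∧
  a δ ∈ hexDomainBoundary (Λ δ) ∧ b δ ∈ hexDomainBoundary (Λ δ) ∧
  a δ ∈ hexDomainBoundary (Λ' δ) ∧ b δ ∈ hexDomainBoundary (Λ' δ) ∧
  Nonempty (HexMidEdgeSAW (Λ' δ) (a δ) (b δ)) ∧
  (∀ v ∈ Λ δ, (δ : ℂ) * hexCenter v ∈ D.carrier ∧ m δ ≤ v.1 1) ∧
  (∀ v ∈ Λ' δ, (δ : ℂ) * hexCenter v ∈ D'.carrier) ∧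
  (∀ v : HexVertex, (δ : ℂ) * hexCenter v ∈ ball (D.pt 0) ρ ∪ ball (D.pt 1) ρ →
  ((v ∈ Λ δ ↔ m δ ≤ v.1 1) ∧ (v ∈ Λ' δ ↔ m δ ≤ v.1 1)))) →
  (∀ K : Set ℂ, IsCompact K → K ⊆ D.carrier →
  ∀ᶠ δ : ℝ in 𝓝[>] 0, ∀ v : HexVertex, (δ : ℂ) * hexCenter v ∈ K → v ∈ Λ δ) →
  (∀ K : Set ℂ, IsCompact K → K ⊆ D'.carrier →
  ∀ᶠ δ : ℝ in 𝓝[>] 0, ∀ v : HexVertex, (δ : ℂ) * hexCenter v ∈ K → v ∈ Λ' δ) →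
  Tendsto (fun δ : ℝ => (δ : ℂ) * hexMidpoint (a δ)) (𝓝[>] 0) (𝓝 (D.pt 0)) →
  Tendsto (fun δ : ℝ => (δ : ℂ) * hexMidpoint (b δ)) (𝓝[>] 0) (𝓝 (D.pt 1)) →
  Tendsto (fun δ : ℝ => (∑ γ : HexMidEdgeSAW (Λ' δ) (a δ) (b δ), hexCriticalFugacity ^ γ.length) /
  (∑ γ : HexMidEdgeSAW (Λ δ) (a δ) (b δ), hexCriticalFugacity ^ γ.length)) (𝓝[>] 0)
  (𝓝 (d ^ ((5 : ℝ) / 8))) := by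
  intro hFRM hAAB D D' ρ φ Φ d Λ Λ' m a b hfl hD' hφ hΦ hd hev hKΛ hKΛ' ha hb
  obtain ⟨hρ, -, -, hflat0, hflat1⟩ := hfl
  obtain ⟨Ψ, L, Lb, Ψ', L', L'b, ρ₁, R, G, κ, hρ₁, hρ₁ρ, hΨinf, hΨb, hLc, hLe, hLb, hΨ'inf, hΨ'b, hL'c,
    hL'e, hL'b, hflat0', hflat1', hfloor, hR, hκ, hGc, hGκ⟩ :=
    exists_conformalPackageGrowth D D' ρ φ Φ d hρ hflat0 hflat1 hD' hφ hΦ hd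
  -- target transport along arbitrary admissible floor families (as c5)
  have hQ : ∀ (e : ℝ → Sym2 HexVertex) (t : ℝ), 0 < t → t ≤ ρ₁ / 4 →
      Tendsto (fun δ : ℝ => (δ : ℂ) * hexMidpoint (e δ)) (𝓝[>] 0) (𝓝 (D.pt 0 + t)) →
      (∀ᶠ δ : ℝ in 𝓝[>] 0, e δ ∈ hexDomainBoundary (Λ δ) ∧ e δ ∈ hexDomainBoundary (Λ' δ) ∧
        Nonempty (HexMidEdgeSAW (Λ δ) (a δ) (e δ)) ∧ Nonempty (HexMidEdgeSAW (Λ' δ) (a δ) (e δ)) ∧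
        ∃ x yy : Site 2, a δ = s((x - Pi.single 1 1, 1), (x, 0)) ∧
          e δ = s((yy - Pi.single 1 1, 1), (yy, 0)) ∧ yy 1 = x 1 ∧ yy ≠ x) →
      Tendsto (fun δ : ℝ =>
        ((∑ γ : HexMidEdgeSAW (Λ' δ) (a δ) (b δ), hexCriticalFugacity ^ γ.length) /
          (∑ γ : HexMidEdgeSAW (Λ' δ) (a δ) (e δ), hexCriticalFugacity ^ γ.length)) *
        ((∑ γ : HexMidEdgeSAW (Λ δ) (a δ) (e δ), hexCriticalFugacity ^ γ.length) /
          (∑ γ : HexMidEdgeSAW (Λ δ) (a δ) (b δ), hexCriticalFugacity ^ γ.length)))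
        (𝓝[>] 0) (𝓝 (R t)) := by
    intro e t ht0 htρ he heE
    obtain ⟨hsfr, hsfr', -, Ls, L's, hLs, hL's, hRt, -⟩ := hfloor t ht0 (by linarith)
    rw [← hRt]
    exact floorFamily_targetTransport hFRM D D' ρ Λ Λ' m a b hρ hD' hev hKΛ hKΛ' ha hb hρ₁ hρ₁ρ hflat0
      hflat1 hflat0' hflat1' Ψ L Lb Ψ' L' L'b hΨinf hΨb hLc hLe hLb hΨ'inf hΨ'b hL'c hL'e hL'b ht0 htρ
      hsfr hsfr' hLs hL's e he heE
  -- the single-family admissibility clause (floor forms of `a δ`, `b δ`)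
  have hdaux : dist (D.pt 0 + ((ρ₁ / 16 : ℝ) : ℂ)) (D.pt 0) = ρ₁ / 16 := dist_pt_add_real _ (by positivity)
  obtain ⟨_, _, -, hevAB⟩ := floorData D D' ρ Λ Λ' m a b hρ hev ha hb (s := D.pt 0 + ((ρ₁ / 16 : ℝ) : ℂ))
    (pt_add_ne (by positivity)) (by simp) (by rw [hdaux]; linarith) one_pos (by rw [hdaux]; linarith)
  have hev₁ : ∀ᶠ δ : ℝ in 𝓝[>] 0,
      hexDomainSimplyConnected (Λ δ) ∧ (hexGraph.induce (↑(Λ δ) : Set HexVertex)).Preconnected ∧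
      a δ ∈ hexDomainBoundary (Λ δ) ∧ b δ ∈ hexDomainBoundary (Λ δ) ∧
      Nonempty (HexMidEdgeSAW (Λ δ) (a δ) (b δ)) ∧
      (∀ v ∈ Λ δ, (δ : ℂ) * hexCenter v ∈ D.carrier ∧ m δ ≤ v.1 1) ∧
      (∀ v : HexVertex, (δ : ℂ) * hexCenter v ∈ ball (D.pt 0) ρ ∪ ball (D.pt 1) ρ →
        (v ∈ Λ δ ↔ m δ ≤ v.1 1)) ∧
      ∃ x x' : Site 2, a δ = s((x - Pi.single 1 1, 1), (x, 0)) ∧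
        b δ = s((x' - Pi.single 1 1, 1), (x', 0)) ∧ x' 1 = x 1 ∧ x' ≠ x := by
    filter_upwards [hev, hevAB] with δ hevδ hAB
    obtain ⟨-, hscΛ, -, hconn, -, haΛ, hbΛ, -, -, -, hΛD, -, hrows⟩ := hevδ
    obtain ⟨x, x', _, hx1, hx'1, -, hx'x, -, hax, hbx, -, -, -, -, -, -, hne_ab, -⟩ := hAB
    exact ⟨hscΛ, hconn, haΛ, hbΛ, hne_ab, hΛD, fun v hv => (hrows v hv).1, x, x', hax, hbx,
      hx'1.trans hx1.symm, hx'x⟩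
  -- the single-domain floor-ratio transport with value `G t`
  have hG : ∀ (e : ℝ → Sym2 HexVertex) (t : ℝ), 0 < t → t ≤ ρ₁ / 4 →
      Tendsto (fun δ : ℝ => (δ : ℂ) * hexMidpoint (e δ)) (𝓝[>] 0) (𝓝 (D.pt 0 + t)) →
      (∀ᶠ δ : ℝ in 𝓝[>] 0, e δ ∈ hexDomainBoundary (Λ δ) ∧ Nonempty (HexMidEdgeSAW (Λ δ) (a δ) (e δ)) ∧
        ∃ x yy : Site 2, a δ = s((x - Pi.single 1 1, 1), (x, 0)) ∧
          e δ = s((yy - Pi.single 1 1, 1), (yy, 0)) ∧ yy 1 = x 1 ∧ yy ≠ x) →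
      Tendsto (fun δ : ℝ =>
        (∑ γ : HexMidEdgeSAW (Λ δ) (a δ) (e δ), hexCriticalFugacity ^ γ.length) /
          (∑ γ : HexMidEdgeSAW (Λ δ) (a δ) (b δ), hexCriticalFugacity ^ γ.length)) (𝓝[>] 0) (𝓝 (G t)) := by
    intro e t ht0 htρ he heE
    obtain ⟨hsfr, -, -, Ls, L's, hLs, -, -, hGt⟩ := hfloor t ht0 (by linarith)
    rw [← hGt]
    exact floorFamily_ratioTransport hFRM D ρ Λ m a b hρ hev₁ hKΛ ha hb hρ₁ hρ₁ρ hflat0 hflat1 Ψ L Lb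
      hΨinf hΨb hLc hLe hLb ht0 htρ hsfr hLs e he heE
  -- the window inequality from the arch aspect bound, and the two bounds of the squeeze
  obtain ⟨θa, θb, C, hθa, hθab, hθb4, hC, hA⟩ := hAAB
  have hWin := windowIneq_of_aspectBound D D' ρ Λ Λ' m a b hρ hev ha hb hρ₁ hρ₁ρ hκ hGc hGκ hG hθa hθab
    hθb4 hC hA
  have hupper := windowUpperBound D D' ρ Λ Λ' m a b hρ hev ha hb hρ₁ hρ₁ρ hR hQ
  have hlower := windowLowerBound_of_windowIneq D D' ρ Λ Λ' m a b hρ hev ha hb hρ₁ hρ₁ρ hR hQ hθa hWin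
  -- conclusion
  rw [Metric.tendsto_nhds]
  intro ε hε
  set c : ℝ := d ^ ((5 : ℝ) / 8) with hc
  set η : ℝ := min (1 / 2) (ε / (2 * (|c| + 3))) with hη
  have hηpos : 0 < η := lt_min (by norm_num) (by positivity)
  have hη2 : η ≤ 1 / 2 := min_le_left _ _
  have hηε : η * (2 * (|c| + 3)) ≤ ε := by
    have : η ≤ ε / (2 * (|c| + 3)) := min_le_right _ _
    rwa [le_div_iff₀ (by positivity)] at this
  filter_upwards [hupper η hηpos, hlower η hηpos hη2] with δ hup hlo
  rw [Real.dist_eq]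
  exact squeeze_abs_lt hηpos hη2 hηε hup hlo

/-! ### The floor class from the floor-ratio limit and the arch aspect bound (the line's compositions) -/

/-- **The floor-class avoidance cocycle from the floor-ratio limit and the ARCH ASPECT BOUND.**
`FloorRatioLimit → ArchAspectBound → HexAvoidanceCocycleFloor`: the restriction cocycle of this file
(`restrictionCocycle_of_aspectBound`), the canonical transfer under the hull approximation
(`FloorRatio.canonicalTransfer_of_hullApprox`, `stub_avoidanceCocycleFloor_hullApprox`) and the sandwich
(`hexAvoidanceCocycleFloor_of_floorRestrictionLimit`).
[cite: LawlerSchrammWerner2004SAW, §3.4 ("SAW satisfies restriction") and Prop. 2] -/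
theorem hexAvoidanceCocycleFloor_of_aspectBound
    (hF : ∀ (D D' : DobrushinDomain) (ρ : ℝ) (Λ : ℝ → Finset HexVertex) (m₀ m m' : ℝ → ℤ) (a b b' : ℝ → Sym2 HexVertex) (Φ : ConformalEquiv D.carrier upperHalfPlaneSet) (L : ℂ → ℂ) (Lb Lb' : ℂ), D'.carrier = D.carrier → D'.pt 0 = D.pt 0 → 0 < ρ → D.carrier ∩ ball (D.pt 0) ρ = {z : ℂ | (D.pt 0).im < z.im} ∩ ball (D.pt 0) ρ → D.carrier ∩ ball (D.pt 1) ρ = {z : ℂ | (D.pt 1).im < z.im} ∩ ball (D.pt 1) ρ → D.carrier ∩ ball (D'.pt 1) ρ = {z : ℂ | (D'.pt 1).im < z.im} ∩ ball (D'.pt 1) ρ → (∀ᶠ δ : ℝ in 𝓝[>] 0, hexDomainSimplyConnected (Λ δ) ∧ a δ ∈ hexDomainBoundary (Λ δ) ∧ b δ ∈ hexDomainBoundary (Λ δ) ∧ b' δ ∈ hexDomainBoundary (Λ δ) ∧ Nonempty (HexMidEdgeSAW (Λ δ) (a δ) (b δ)) ∧ Nonempty (HexMidEdgeSAW (Λ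 δ) (a δ) (b' δ)) ∧ (hexGraph.induce (↑(Λ δ) : Set HexVertex)).Preconnected ∧ (∀ v ∈ Λ δ, (δ : ℂ) * hexCenter v ∈ D.carrier) ∧ (∀ v : HexVertex, (δ : ℂ) * hexCenter v ∈ ball (D.pt 0) ρ → (v ∈ Λ δ ↔ m₀ δ ≤ v.1 1)) ∧ (∀ v : HexVertex, (δ : ℂ) * hexCenter v ∈ ball (D.pt 1) ρ → (v ∈ Λ δ ↔ m δ ≤ v.1 1)) ∧ (∀ v : HexVertex, (δ : ℂ) * hexCenter v ∈ ball (D'.pt 1) ρ → (v ∈ Λ δ ↔ m' δ ≤ v.1 1))) → (∀ K : Set ℂ, IsCompact K → K ⊆ D.carrier → ∀ᶠ δ : ℝ in 𝓝[>] 0, ∀ v : HexVertex, (δ : ℂ) * hexCenter v ∈ K → v ∈ Λ δ) → Tendsto (fun δ : ℝ => (δ : ℂ) * hexMidpoint (a δ)) (𝓝[>] 0) (𝓝 (D.pt 0)) → Tendsto (fun δ : ℝ => (δ : ℂ) * hexMidpoint (b δ)) (𝓝[>] 0) (𝓝 (D.pt 1)) → Tendsto (fun δ : ℝ => (δ : ℂ)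 * hexMidpoint (b' δ)) (𝓝[>] 0) (𝓝 (D'.pt 1)) → Tendsto (fun x => ‖Φ x‖) (𝓝[D.carrier] (D.pt 0)) atTop → Φ.HasBoundaryValue (D.pt 1) 0 → ContinuousOn L D.carrier → (∀ z ∈ D.carrier, Complex.exp (L z) = deriv Φ z) → Tendsto L (𝓝[D.carrier] (D.pt 1)) (𝓝 Lb) → Tendsto L (𝓝[D.carrier] (D'.pt 1)) (𝓝 Lb') → Tendsto (fun δ : ℝ => ‖hexParafermionicObservable (Λ δ) (a δ) hexCriticalFugacity (5 / 8) (b' δ) / hexParafermionicObservable (Λ δ) (a δ) hexCriticalFugacity (5 / 8) (b δ)‖) (𝓝[>] 0) (𝓝 (Real.exp ((5 / 8) * (Lb' - Lb).re))))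
    (hA : ∃ θa θb C : ℝ, 0 < θa ∧ θa < θb ∧ θb ≤ 1 / 4 ∧ 0 < C ∧ ∀ θ₁ : ℝ, 0 < θ₁ → θ₁ < θa →
      ∃ R₀ : ℝ, 0 < R₀ ∧ ∀ R : ℝ, R₀ ≤ R →
      ∀ (x : Site 2) (L B : Finset HexVertex) (S S' : Finset ℤ),
        (∀ v ∈ L, x 1 ≤ v.1 1) →
        (∀ v : HexVertex, v ∈ B ↔ (x 1 ≤ v.1 1 ∧
          dist (hexCenter v) (hexMidpoint s((x - Pi.single 1 1, 1), (x, 0))) ≤ R)) →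
        (∀ d : ℤ, d ∈ S ↔ (θ₁ * R ≤ (d : ℝ) ∧ (d : ℝ) ≤ θa * R)) →
        (∀ d : ℤ, d ∈ S' ↔ (θa * R ≤ (d : ℝ) ∧ (d : ℝ) ≤ θb * R)) →
        ∑ d ∈ S, (∑ γ : HexMidEdgeSAW L s((x - Pi.single 1 1, 1), (x, 0))
            s((x + Pi.single 0 d - Pi.single 1 1, 1), (x + Pi.single 0 d, 0)),
          if ∃ v ∈ γ.verts, R ≤ dist (hexCenter v) (hexMidpoint s((x - Pi.single 1 1, 1), (x, 0)))
          then hexCriticalFugacity ^ γ.length else 0) ≤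
        C * ∑ d ∈ S', ∑ γ : HexMidEdgeSAW B s((x - Pi.single 1 1, 1), (x, 0))
            s((x + Pi.single 0 d - Pi.single 1 1, 1), (x + Pi.single 0 d, 0)), hexCriticalFugacity ^ γ.length) :
    ∀ (D D' : DobrushinDomain) (ρ : ℝ) (a b : ℝ → HexVertex) (μ : Measure (CurveClass ℂ)),
      (0 < ρ ∧ (D.pt 1).im = (D.pt 0).im ∧ D.carrier ⊆ {z : ℂ | (D.pt 0).im < z.im} ∧
        D.carrier ∩ ball (D.pt 0) ρ = {z : ℂ | (D.pt 0).im < z.im} ∩ ball (D.pt 0) ρ ∧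
        D.carrier ∩ ball (D.pt 1) ρ = {z : ℂ | (D.pt 1).im < z.im} ∩ ball (D.pt 1) ρ) →
      IsEmbEndpointApprox hexGraph hexCenter D a b →
      (∀ᶠ δ : ℝ in 𝓝[>] 0,
        (a δ ∈ embMeshDomain hexGraph hexCenter D.carrier δ ∧
          ∃ w, hexGraph.Adj (a δ) w ∧ ¬ (hexDomainGraph D.carrier δ).Adj (a δ) w) ∧
        (b δ ∈ embMeshDomain hexGraph hexCenter D.carrier δ ∧
          ∃ w, hexGraph.Adj (b δ) w ∧ ¬ (hexDomainGraph D.carrier δ).Adj (b δ) w)) →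
      D.IsHullSubdomain D' → IsSLELaw ((8 : ℝ≥0) / 3) D μ →
      Tendsto (fun δ : ℝ =>
        ((hexSAWLaw D.carrier δ (a δ) (b δ)).map
            (fun γ : HexDomainSAW D.carrier δ (a δ) (b δ) => γ.curve))
          (CurveClass.rangeSubset (closure D'.carrier)))
        (𝓝[>] 0) (𝓝 (μ (CurveClass.rangeSubset (closure D'.carrier)))) :=
  hexAvoidanceCocycleFloor_of_floorRestrictionLimit
    (canonicalTransfer_of_hullApprox stub_avoidanceCocycleFloor_hullApprox
      (restrictionCocycle_of_aspectBound hF hA))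

/-- **The crux on the floor class from the floor-ratio limit, the arch aspect bound and non-retracing** (the line's
primary composition after the lead's c6 reshape: statement 1 = `FloorRatioLimit`, lever = `ArchAspectBound`, regularity =
`HexNonRetracingFloor`; statements 3–4–6 landed).
[cite: LawlerSchrammWerner2004SAW, §3.4 ("SAW satisfies restriction") and Prop. 2] -/
theorem hexConjectureFloor_of_aspectBound
    (hF : ∀ (D D' : DobrushinDomain) (ρ : ℝ) (Λ : ℝ → Finset HexVertex) (m₀ m m' : ℝ → ℤ) (a b b' : ℝ → Sym2 HexVertex) (Φ : ConformalEquiv D.carrier upperHalfPlaneSet) (L : ℂ → ℂ) (Lb Lb' : ℂ), D'.carrier = D.carrier → D'.pt 0 = D.pt 0 → 0 < ρ → D.carrier ∩ ball (D.pt 0) ρ = {z : ℂ | (D.pt 0).im < z.im} ∩ ball (D.pt 0) ρ → D.carrier ∩ ball (D.pt 1) ρ = {z : ℂ | (D.pt 1).im < z.im} ∩ ball (D.pt 1) ρ → D.carrier ∩ ball (D'.pt 1) ρ = {z : ℂ | (D'.pt 1).im < z.im} ∩ ball (D'.pt 1) ρ → (∀ᶠ δ : ℝ in 𝓝[>] 0,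 hexDomainSimplyConnected (Λ δ) ∧ a δ ∈ hexDomainBoundary (Λ δ) ∧ b δ ∈ hexDomainBoundary (Λ δ) ∧ b' δ ∈ hexDomainBoundary (Λ δ) ∧ Nonempty (HexMidEdgeSAW (Λ δ) (a δ) (b δ)) ∧ Nonempty (HexMidEdgeSAW (Λ δ) (a δ) (b' δ)) ∧ (hexGraph.induce (↑(Λ δ) : Set HexVertex)).Preconnected ∧ (∀ v ∈ Λ δ, (δ : ℂ) * hexCenter v ∈ D.carrier) ∧ (∀ v : HexVertex, (δ : ℂ) * hexCenter v ∈ ball (D.pt 0) ρ → (v ∈ Λ δ ↔ m₀ δ ≤ v.1 1)) ∧ (∀ v : HexVertex, (δ : ℂ) * hexCenter v ∈ ball (D.pt 1) ρ → (v ∈ Λ δ ↔ m δ ≤ v.1 1)) ∧ (∀ v : HexVertex, (δ : ℂ) * hexCenter v ∈ ball (D'.pt 1) ρ → (v ∈ Λ δ ↔ m' δ ≤ v.1 1))) → (∀ K : Set ℂ, IsCompact K → K ⊆ D.carrier → ∀ᶠ δ : ℝ in 𝓝[>] 0, ∀ v : HexVertex, (δ : ℂ) * hexCenter v ∈ K →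 v ∈ Λ δ) → Tendsto (fun δ : ℝ => (δ : ℂ) * hexMidpoint (a δ)) (𝓝[>] 0) (𝓝 (D.pt 0)) → Tendsto (fun δ : ℝ => (δ : ℂ) * hexMidpoint (b δ)) (𝓝[>] 0) (𝓝 (D.pt 1)) → Tendsto (fun δ : ℝ => (δ : ℂ) * hexMidpoint (b' δ)) (𝓝[>] 0) (𝓝 (D'.pt 1)) → Tendsto (fun x => ‖Φ x‖) (𝓝[D.carrier] (D.pt 0)) atTop → Φ.HasBoundaryValue (D.pt 1) 0 → ContinuousOn L D.carrier → (∀ z ∈ D.carrier, Complex.exp (L z) = deriv Φ z) → Tendsto L (𝓝[D.carrier] (D.pt 1)) (𝓝 Lb) → Tendsto L (𝓝[D.carrier] (D'.pt 1)) (𝓝 Lb') → Tendsto (fun δ : ℝ => ‖hexParafermionicObservable (Λ δ) (a δ) hexCriticalFugacity (5 / 8) (b' δ) / hexParafermionicObservable (Λ δ) (a δ) hexCriticalFugacity (5 / 8) (b δ)‖) (𝓝[>] 0) (𝓝 (Real.exp ((5 / 8) * (Lb' - Lb).re))))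
    (hA : ∃ θa θb C : ℝ, 0 < θa ∧ θa < θb ∧ θb ≤ 1 / 4 ∧ 0 < C ∧ ∀ θ₁ : ℝ, 0 < θ₁ → θ₁ < θa →
      ∃ R₀ : ℝ, 0 < R₀ ∧ ∀ R : ℝ, R₀ ≤ R →
      ∀ (x : Site 2) (L B : Finset HexVertex) (S S' : Finset ℤ),
        (∀ v ∈ L, x 1 ≤ v.1 1) →
        (∀ v : HexVertex, v ∈ B ↔ (x 1 ≤ v.1 1 ∧
          dist (hexCenter v) (hexMidpoint s((x - Pi.single 1 1, 1), (x, 0))) ≤ R)) →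
        (∀ d : ℤ, d ∈ S ↔ (θ₁ * R ≤ (d : ℝ) ∧ (d : ℝ) ≤ θa * R)) →
        (∀ d : ℤ, d ∈ S' ↔ (θa * R ≤ (d : ℝ) ∧ (d : ℝ) ≤ θb * R)) →
        ∑ d ∈ S, (∑ γ : HexMidEdgeSAW L s((x - Pi.single 1 1, 1), (x, 0))
            s((x + Pi.single 0 d - Pi.single 1 1, 1), (x + Pi.single 0 d, 0)),
          if ∃ v ∈ γ.verts, R ≤ dist (hexCenter v) (hexMidpoint s((x - Pi.single 1 1, 1), (x, 0)))
          then hexCriticalFugacity ^ γ.length else 0) ≤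
        C * ∑ d ∈ S', ∑ γ : HexMidEdgeSAW B s((x - Pi.single 1 1, 1), (x, 0))
            s((x + Pi.single 0 d - Pi.single 1 1, 1), (x + Pi.single 0 d, 0)), hexCriticalFugacity ^ γ.length)
    (hNR : ∀ (D : DobrushinDomain) (ρ : ℝ) (a b : ℝ → HexVertex),
      (0 < ρ ∧ (D.pt 1).im = (D.pt 0).im ∧ D.carrier ⊆ {z : ℂ | (D.pt 0).im < z.im} ∧
        D.carrier ∩ ball (D.pt 0) ρ = {z : ℂ | (D.pt 0).im < z.im} ∩ ball (D.pt 0) ρ ∧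
        D.carrier ∩ ball (D.pt 1) ρ = {z : ℂ | (D.pt 1).im < z.im} ∩ ball (D.pt 1) ρ) →
      IsEmbEndpointApprox hexGraph hexCenter D a b →
      (∀ᶠ δ : ℝ in 𝓝[>] 0,
        (a δ ∈ embMeshDomain hexGraph hexCenter D.carrier δ ∧
          ∃ w, hexGraph.Adj (a δ) w ∧ ¬ (hexDomainGraph D.carrier δ).Adj (a δ) w) ∧
        (b δ ∈ embMeshDomain hexGraph hexCenter D.carrier δ ∧
          ∃ w, hexGraph.Adj (b δ) w ∧ ¬ (hexDomainGraph D.carrier δ).Adj (b δ) w)) →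
      ∀ ℓ : ℝ, 0 < ℓ → ∀ η : ℝ, 0 < η → ∃ ε : ℝ, 0 < ε ∧ ∀ᶠ δ : ℝ in 𝓝[>] 0,
        hexSAWLaw D.carrier δ (a δ) (b δ)
            {γ | ∃ c : Curve ℂ, CurveClass.mk c = γ.curve ∧ ∃ s t : Fin 3 → unitInterval,
              (∀ i, s i ≤ t i) ∧ t 0 < s 1 ∧ t 1 < s 2 ∧
              (∀ i, ℓ ≤ Metric.diam ((⇑c) '' Set.Icc (s i) (t i))) ∧
              ∀ i j, Metric.hausdorffDist ((⇑c) '' Set.Icc (s i) (t i))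
                ((⇑c) '' Set.Icc (s j) (t j)) ≤ ε} ≤ ENNReal.ofReal η) :
    ∀ (D : DobrushinDomain) (ρ : ℝ) (a b : ℝ → HexVertex),
      (0 < ρ ∧ (D.pt 1).im = (D.pt 0).im ∧ D.carrier ⊆ {z : ℂ | (D.pt 0).im < z.im} ∧
        D.carrier ∩ ball (D.pt 0) ρ = {z : ℂ | (D.pt 0).im < z.im} ∩ ball (D.pt 0) ρ ∧
        D.carrier ∩ ball (D.pt 1) ρ = {z : ℂ | (D.pt 1).im < z.im} ∩ ball (D.pt 1) ρ) →
      IsEmbEndpointApprox hexGraph hexCenter D a b →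
      (∀ᶠ δ : ℝ in 𝓝[>] 0,
        (a δ ∈ embMeshDomain hexGraph hexCenter D.carrier δ ∧
          ∃ w, hexGraph.Adj (a δ) w ∧ ¬ (hexDomainGraph D.carrier δ).Adj (a δ) w) ∧
        (b δ ∈ embMeshDomain hexGraph hexCenter D.carrier δ ∧
          ∃ w, hexGraph.Adj (b δ) w ∧ ¬ (hexDomainGraph D.carrier δ).Adj (b δ) w)) →
      ConvergesInLawToSLE ((8 : ℝ≥0) / 3) D
        (fun δ (γ : HexDomainSAW D.carrier δ (a δ) (b δ)) => γ.curve)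
        (fun δ => hexSAWLaw D.carrier δ (a δ) (b δ)) :=
  hexConjectureFloor_of_cocycle_nonRetracing (hexAvoidanceCocycleFloor_of_aspectBound hF hA) hNR

/-- **The floor class of DCS Conjecture 1 from three boundary estimates** — floor-ratio limit (boundary conformal
covariance, exponent 5/8), ARCH ASPECT BOUND (an `η`-free one-scale comparison of two functionals of the critical half-plane
arch measure), uniform injectivity modulus: convergence in law of the critical hexagonal SAW to chordal SLE(8/3) on every
floor domain with discrete-boundary endpoints.  No bulk observable, no tightness input, no locality input.
[cite: LawlerSchrammWerner2004SAW, §3.4 ("SAW satisfies restriction") and Prop. 2] -/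
theorem hexConjectureFloor_of_aspectEstimates
    (hF : ∀ (D D' : DobrushinDomain) (ρ : ℝ) (Λ : ℝ → Finset HexVertex) (m₀ m m' : ℝ → ℤ) (a b b' : ℝ → Sym2 HexVertex) (Φ : ConformalEquiv D.carrier upperHalfPlaneSet) (L : ℂ → ℂ) (Lb Lb' : ℂ), D'.carrier = D.carrier → D'.pt 0 = D.pt 0 → 0 < ρ → D.carrier ∩ ball (D.pt 0) ρ = {z : ℂ | (D.pt 0).im < z.im} ∩ ball (D.pt 0) ρ → D.carrier ∩ ball (D.pt 1) ρ = {z : ℂ | (D.pt 1).im < z.im} ∩ ball (D.pt 1) ρ → D.carrier ∩ ball (D'.pt 1) ρ = {z : ℂ | (D'.pt 1).im < z.im} ∩ ball (D'.pt 1) ρ → (∀ᶠ δ : ℝ in 𝓝[>] 0, hexDomainSimplyConnected (Λ δ) ∧ a δ ∈ hexDomainBoundary (Λ δ) ∧ b δ ∈ hexDomainBoundary (Λ δ) ∧ b' δ ∈ hexDomainBoundary (Λ δ) ∧ Nonempty (HexMidEdgeSAW (Λ δ) (a δ) (b δ)) ∧ Nonempty (HexMidEdgeSAW (Λ δ) (a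 δ) (b' δ)) ∧ (hexGraph.induce (↑(Λ δ) : Set HexVertex)).Preconnected ∧ (∀ v ∈ Λ δ, (δ : ℂ) * hexCenter v ∈ D.carrier) ∧ (∀ v : HexVertex, (δ : ℂ) * hexCenter v ∈ ball (D.pt 0) ρ → (v ∈ Λ δ ↔ m₀ δ ≤ v.1 1)) ∧ (∀ v : HexVertex, (δ : ℂ) * hexCenter v ∈ ball (D.pt 1) ρ → (v ∈ Λ δ ↔ m δ ≤ v.1 1)) ∧ (∀ v : HexVertex, (δ : ℂ) * hexCenter v ∈ ball (D'.pt 1) ρ → (v ∈ Λ δ ↔ m' δ ≤ v.1 1))) → (∀ K : Set ℂ, IsCompact K → K ⊆ D.carrier → ∀ᶠ δ : ℝ in 𝓝[>] 0, ∀ v : HexVertex, (δ : ℂ) * hexCenter v ∈ K → v ∈ Λ δ) → Tendsto (fun δ : ℝ => (δ : ℂ) * hexMidpoint (a δ)) (𝓝[>] 0) (𝓝 (D.pt 0)) → Tendsto (fun δ : ℝ => (δ : ℂ) * hexMidpoint (b δ)) (𝓝[>] 0) (𝓝 (D.pt 1)) → Tendsto (fun δ : ℝ => (δ : ℂ) *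 hexMidpoint (b' δ)) (𝓝[>] 0) (𝓝 (D'.pt 1)) → Tendsto (fun x => ‖Φ x‖) (𝓝[D.carrier] (D.pt 0)) atTop → Φ.HasBoundaryValue (D.pt 1) 0 → ContinuousOn L D.carrier → (∀ z ∈ D.carrier, Complex.exp (L z) = deriv Φ z) → Tendsto L (𝓝[D.carrier] (D.pt 1)) (𝓝 Lb) → Tendsto L (𝓝[D.carrier] (D'.pt 1)) (𝓝 Lb') → Tendsto (fun δ : ℝ => ‖hexParafermionicObservable (Λ δ) (a δ) hexCriticalFugacity (5 / 8) (b' δ) / hexParafermionicObservable (Λ δ) (a δ) hexCriticalFugacity (5 / 8) (b δ)‖) (𝓝[>] 0) (𝓝 (Real.exp ((5 / 8) * (Lb' - Lb).re))))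
    (hA : ∃ θa θb C : ℝ, 0 < θa ∧ θa < θb ∧ θb ≤ 1 / 4 ∧ 0 < C ∧ ∀ θ₁ : ℝ, 0 < θ₁ → θ₁ < θa →
      ∃ R₀ : ℝ, 0 < R₀ ∧ ∀ R : ℝ, R₀ ≤ R →
      ∀ (x : Site 2) (L B : Finset HexVertex) (S S' : Finset ℤ),
        (∀ v ∈ L, x 1 ≤ v.1 1) →
        (∀ v : HexVertex, v ∈ B ↔ (x 1 ≤ v.1 1 ∧
          dist (hexCenter v) (hexMidpoint s((x - Pi.single 1 1, 1), (x, 0))) ≤ R)) →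
        (∀ d : ℤ, d ∈ S ↔ (θ₁ * R ≤ (d : ℝ) ∧ (d : ℝ) ≤ θa * R)) →
        (∀ d : ℤ, d ∈ S' ↔ (θa * R ≤ (d : ℝ) ∧ (d : ℝ) ≤ θb * R)) →
        ∑ d ∈ S, (∑ γ : HexMidEdgeSAW L s((x - Pi.single 1 1, 1), (x, 0))
            s((x + Pi.single 0 d - Pi.single 1 1, 1), (x + Pi.single 0 d, 0)),
          if ∃ v ∈ γ.verts, R ≤ dist (hexCenter v) (hexMidpoint s((x - Pi.single 1 1, 1), (x, 0)))
          then hexCriticalFugacity ^ γ.length else 0) ≤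
        C * ∑ d ∈ S', ∑ γ : HexMidEdgeSAW B s((x - Pi.single 1 1, 1), (x, 0))
            s((x + Pi.single 0 d - Pi.single 1 1, 1), (x + Pi.single 0 d, 0)), hexCriticalFugacity ^ γ.length)
    (hU : ∀ (D : DobrushinDomain) (ρ : ℝ) (a b : ℝ → HexVertex),
      (0 < ρ ∧ (D.pt 1).im = (D.pt 0).im ∧ D.carrier ⊆ {z : ℂ | (D.pt 0).im < z.im} ∧
        D.carrier ∩ ball (D.pt 0) ρ = {z : ℂ | (D.pt 0).im < z.im} ∩ ball (D.pt 0) ρ ∧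
        D.carrier ∩ ball (D.pt 1) ρ = {z : ℂ | (D.pt 1).im < z.im} ∩ ball (D.pt 1) ρ) →
      (IsEmbEndpointApprox hexGraph hexCenter D a b ∧ ∀ᶠ δ : ℝ in 𝓝[>] 0,
      (∃ u : HexVertex, hexGraph.Adj (a δ) u ∧ ((δ : ℂ) * hexCenter u).im ≤ (D.pt 0).im) ∧
      (∃ u : HexVertex, hexGraph.Adj (b δ) u ∧ ((δ : ℂ) * hexCenter u).im ≤ (D.pt 1).im)) →
      ∀ ε η : ℝ, 0 < ε → 0 < η → ∃ θ : ℝ, 0 < θ ∧ ∀ᶠ δ : ℝ in 𝓝[>] 0,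
        hexSAWLaw D.carrier δ (a δ) (b δ) {γ | γ.curve ∉ CurveClass.modulusClass ε θ} ≤
          ENNReal.ofReal η) :
    ∀ (D : DobrushinDomain) (ρ : ℝ) (a b : ℝ → HexVertex),
      (0 < ρ ∧ (D.pt 1).im = (D.pt 0).im ∧ D.carrier ⊆ {z : ℂ | (D.pt 0).im < z.im} ∧
        D.carrier ∩ ball (D.pt 0) ρ = {z : ℂ | (D.pt 0).im < z.im} ∩ ball (D.pt 0) ρ ∧
        D.carrier ∩ ball (D.pt 1) ρ = {z : ℂ | (D.pt 1).im < z.im} ∩ ball (D.pt 1) ρ) →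
      IsEmbEndpointApprox hexGraph hexCenter D a b →
      (∀ᶠ δ : ℝ in 𝓝[>] 0,
        (a δ ∈ embMeshDomain hexGraph hexCenter D.carrier δ ∧
          ∃ w, hexGraph.Adj (a δ) w ∧ ¬ (hexDomainGraph D.carrier δ).Adj (a δ) w) ∧
        (b δ ∈ embMeshDomain hexGraph hexCenter D.carrier δ ∧
          ∃ w, hexGraph.Adj (b δ) w ∧ ¬ (hexDomainGraph D.carrier δ).Adj (b δ) w)) →
      ConvergesInLawToSLE ((8 : ℝ≥0) / 3) D
        (fun δ (γ : HexDomainSAW D.carrier δ (a δ) (b δ)) => γ.curve)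
        (fun δ => hexSAWLaw D.carrier δ (a δ) (b δ)) :=
  hexConjectureFloor_of_aspectBound hF hA (nonRetracingFloor_of_uniformModulus hU)



/-! ### Registered form -/

/-- **Registered sub-goal `stub_distPtAddReal`** (crux item stmt-CriticalPhenomena-0808, line `root-locality-replaces-loewner`,
lead continuation c6): distance of a floor point from the marked point (`dist_pt_add_real`). [folklore] -/
theorem stub_distPtAddReal : ∀ (p : ℂ) (t : ℝ), 0 < t → dist (p + (t : ℂ)) p = t :=
  fun p _ ht => dist_pt_add_real p ht

end Summit.CriticalPhenomena.SAWScalingLimit.Theorems.HexConjecture.RootLocality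

end
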